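import Summits.QuantumFields.YangMills.Theorems.HypercubicLimit.Negative.ExtendByZero
import Summits.QuantumFields.YangMills.Theses.CoincidenceRotationBootstrap

/-!
# `HypercubicLimit` (re-typed, stmt-QuantumFields-16154) ⇔ its ONE-FIELD version at weak coupling

Support file for the crux `stmt-QuantumFields-16154`
(`Summit.QuantumFields.YangMills.Theses.CoincidenceRotationBootstrap.HypercubicLimit`, verbatim
`= MirrorModularBoosts.WeakCouplingHypercubicLimit`; the 2026-08-16 re-type of `stmt-QuantumFields-8646` by the
first conjunct `sch.HasWeakCouplingLimit`).  It replaces, for the re-typed crux, the reduction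
`Negative.OneFieldReduction.hypercubicLimit_iff_oneField`, whose statement names the dropped
`PencilRigidity.HypercubicLimit` (that module is dead code and is not imported here); the construction is the
same (restriction `restrictTo`; extension by zero `extendByZero` of `Negative.ExtendByZero` with every other
species renormalised to zero), plus the observation that silencing species keeps `β`, hence
`HasWeakCouplingLimit`.

* `latticeSchwinger_silence_of_ne`, `latticeSchwinger_silence_self` — silencing every species but one (a
  structure update of the scheme: `c_s ≡ 0` for `s ≠ s₀`; `a`, `β`, `L`, `m` untouched; no new definition);
* `hypercubicLimit_iff_oneFieldWeak` — **the crux ⇔ for every compact simple `G` there are `r`, a scheme `sch`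
  AT WEAK COUPLING and ONE Schwinger family `S₁` on `ℝ⁴` (the curvature field) with E0–E4 + translations +
  proper-hypercubic invariance on `⁰𝒮`, convergence of the renormalised curvature `n`-point functions along `sch`,
  non-triviality, non-Gaussianity, `HasMassGap Δ` and `HasLatticeMassGap r sch Δ`** (registered sub-goal of the
  crux; every line skeleton on this crux directory ends with this reduction). [folklore]
-/

noncomputable section

open scoped SchwartzMap ComplexConjugate
open MeasureTheory Filter Topology Complex
open Literature.MathematicalPhysics.AQFT Literature.MathematicalPhysics.QuantumLattice
open Literature.MathematicalPhysics.QuantumFieldTheory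
open Summit.QuantumFields.YangMills.Theorems.HypercubicLimit.Negative

namespace Summit.QuantumFields.YangMills.Theorems.HypercubicLimit.OneFieldWeak

section Silence

variable {G : Type} [Group G] [TopologicalSpace G] [IsTopologicalGroup G] [CompactSpace G]
  [MeasurableSpace G] [BorelSpace G]

/-- SILENCING every species but `s₀` (keep the renormalisations of `s₀`, renormalise every other species to
`0`; spacings, couplings, volumes, counterterms untouched — written as a structure update, no new definition):
with a silenced species in the string, the lattice `n`-point function vanishes.
-- adapted from Theorems/HypercubicLimit/Negative/OneFieldReduction.lean (`onlySpecies`) [folklore] -/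
theorem latticeSchwinger_silence_of_ne (r : LatticeRep G) (sch : SpeciesScheme (YMSpecies G))
    (s₀ : YMSpecies G) (k n : ℕ) (σ : Fin n → YMSpecies G) (f : Fin n → 𝓢(EuclideanSpace ℝ (Fin 4), ℝ))
    {i₀ : Fin n} (hi₀ : σ i₀ ≠ s₀) :
    latticeSchwinger r.ρ ({ sch with c := fun s k => by classical exact if s = s₀ then sch.c s k else 0 } : SpeciesScheme (YMSpecies G)) (fun s => s.F) k n σ f = 0 := by
  unfold latticeSchwinger
  have h0 : (({ sch with c := fun s k => by classical exact if s = s₀ then sch.c s k else 0 } : SpeciesScheme (YMSpecies G))).c (σ i₀) k = 0 := by simp [hi₀]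
  have : ∀ U : GaugeConfig 4 ((({ sch with c := fun s k => by classical exact if s = s₀ then sch.c s k else 0 } : SpeciesScheme (YMSpecies G))).side k) G,
      ∏ i, smearedLatticeField ((fun s : YMSpecies G => s.F) (σ i))
        (Literature.Probability.LatticeModels.box 4 ((({ sch with c := fun s k => by classical exact if s = s₀ then sch.c s k else 0 } : SpeciesScheme (YMSpecies G))).L k))
        ((({ sch with c := fun s k => by classical exact if s = s₀ then sch.c s k else 0 } : SpeciesScheme (YMSpecies G))).a k) ((({ sch with c := fun s k => by classical exact if s = s₀ then sch.c s k else 0 } : SpeciesScheme (YMSpecies G))).c (σ i) k) ((({ sch with c := fun s k => by classical exact if s = s₀ then sch.c s k else 0 } : SpeciesScheme (YMSpecies G))).m (σ i) k)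
        (f i) (torusLift ((({ sch with c := fun s k => by classical exact if s = s₀ then sch.c s k else 0 } : SpeciesScheme (YMSpecies G))).side k) U) = 0 := fun U =>
    Finset.prod_eq_zero (Finset.mem_univ i₀) (by rw [h0]; simp [smearedLatticeField])
  simp_rw [this, integral_zero]

/-- On the kept species the silenced scheme has the original lattice functions. [folklore] -/
theorem latticeSchwinger_silence_self (r : LatticeRep G) (sch : SpeciesScheme (YMSpecies G))
    (s₀ : YMSpecies G) (k n : ℕ) (f : Fin n → 𝓢(EuclideanSpace ℝ (Fin 4), ℝ)) :
    latticeSchwinger r.ρ ({ sch with c := fun s k => by classical exact if s = s₀ then sch.c s k else 0 } : SpeciesScheme (YMSpecies G)) (fun s => s.F) k n (fun _ => s₀) f =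
      latticeSchwinger r.ρ sch (fun s => s.F) k n (fun _ => s₀) f := by
  unfold latticeSchwinger
  simp only [↓reduceIte]
  rfl

end Silence

/-- **`HypercubicLimit` (re-typed, at weak coupling) ⇔ its one-field version.**  The labelled all-species
packaging of the crux carries no weight beyond `HasLatticeMassGap` and `HasWeakCouplingLimit`, both of which read
`(a_k, β_k, L_k)` only: `→` restrict the labelled family to the constant curvature string (`restrictTo`); `←`
silence every other species (`β` untouched) and extend the one-field family by zero (`extendByZero`).
A prover may therefore construct ONE scalar field along a weak-coupling scheme. [folklore] -/
theorem hypercubicLimit_iff_oneFieldWeak :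
    Summit.QuantumFields.YangMills.Theses.CoincidenceRotationBootstrap.HypercubicLimit ↔
      ∀ (G : Type) [Group G] [TopologicalSpace G] [IsTopologicalGroup G] [CompactSpace G],
        IsCompactSimpleLieGroup G →
          letI : MeasurableSpace G := borel G
          haveI : BorelSpace G := ⟨rfl⟩
          ∃ (r : LatticeRep G) (sch : SpeciesScheme (YMSpecies G)) (S₁ : SchwingerFamily (EuclideanSpace ℝ (Fin 4))),
            sch.HasWeakCouplingLimit ∧ ((S₁.toLabelled.IsNormalized ∧ S₁.toLabelled.IsHermitian ∧ S₁.toLabelled.HasLinearGrowth ∧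
            S₁.toLabelled.IsReflectionPositive ∧ S₁.toLabelled.IsSymmetric ∧ S₁.toLabelled.HasClusterProperty ∧
            (∀ (n : ℕ) (k : Fin n → Unit) (a : EuclideanSpace ℝ (Fin 4)) (F : 𝓢((Fin n → EuclideanSpace ℝ (Fin 4)), ℂ)),
              IsOffDiagonal F → S₁.toLabelled n k (translateMulti a F) = S₁.toLabelled n k F) ∧
            (∀ (n : ℕ) (k : Fin n → Unit) (R : EuclideanSpace ℝ (Fin 4) ≃ₗᵢ[ℝ] EuclideanSpace ℝ (Fin 4)),
              LinearMap.det (R.toLinearEquiv : EuclideanSpace ℝ (Fin 4) →ₗ[ℝ] EuclideanSpace ℝ (Fin 4)) = 1 →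
              (∀ i : Fin 4, ∃ j : Fin 4, R (EuclideanSpace.single i 1) = EuclideanSpace.single j 1 ∨
                R (EuclideanSpace.single i 1) = -EuclideanSpace.single j 1) →
              ∀ F : 𝓢((Fin n → EuclideanSpace ℝ (Fin 4)), ℂ), IsOffDiagonal F →
                S₁.toLabelled n k (linActMulti R F) = S₁.toLabelled n k F)) ∧
          (∀ (n : ℕ), n ≠ 0 → ∀ (f : Fin n → 𝓢(EuclideanSpace ℝ (Fin 4), ℝ))
              (F : 𝓢((Fin n → EuclideanSpace ℝ (Fin 4)), ℂ)),
            IsTensorOf F (fun i => ofRealTest (f i)) → IsOffDiagonal F →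
              Tendsto (fun k : ℕ =>
                ((latticeSchwinger r.ρ sch (fun s => s.F) k n (fun _ => r.curvature) f : ℝ) : ℂ))
                atTop (𝓝 (S₁ n F))) ∧
          (∃ (F₁ G₁ : 𝓢((Fin 1 → EuclideanSpace ℝ (Fin 4)), ℂ)) (H₁ : 𝓢((Fin (1 + 1) → EuclideanSpace ℝ (Fin 4)), ℂ)),
            IsTimeOrdered F₁ ∧ IsTimeOrdered G₁ ∧ IsAppendTensorOf H₁ (osAdjoint F₁) G₁ ∧
              S₁.toLabelled (1 + 1) (fun _ => ()) H₁ ≠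
                S₁.toLabelled 1 (fun _ => ()) (osAdjoint F₁) * S₁.toLabelled 1 (fun _ => ()) G₁) ∧
          (∃ (f g h : 𝓢(EuclideanSpace ℝ (Fin 4), ℂ)) (Ffgh : 𝓢((Fin 3 → EuclideanSpace ℝ (Fin 4)), ℂ))
              (Fgh Ffh Ffg : 𝓢((Fin 2 → EuclideanSpace ℝ (Fin 4)), ℂ)) (Ff Fg Fh : 𝓢((Fin 1 → EuclideanSpace ℝ (Fin 4)), ℂ)),
            IsTensorOf Ffgh ![f, g, h] ∧ IsOffDiagonal Ffgh ∧ IsTensorOf Fgh ![g, h] ∧ IsTensorOf Ffh ![f, h] ∧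
            IsTensorOf Ffg ![f, g] ∧ IsTensorOf Ff ![f] ∧ IsTensorOf Fg ![g] ∧ IsTensorOf Fh ![h] ∧
              S₁.toLabelled 3 (fun _ => ()) Ffgh - S₁.toLabelled 1 (fun _ => ()) Ff * S₁.toLabelled 2 (fun _ => ()) Fgh -
                S₁.toLabelled 1 (fun _ => ()) Fg * S₁.toLabelled 2 (fun _ => ()) Ffh -
                S₁.toLabelled 1 (fun _ => ()) Fh * S₁.toLabelled 2 (fun _ => ()) Ffg +
                2 * (S₁.toLabelled 1 (fun _ => ()) Ff * S₁.toLabelled 1 (fun _ => ()) Fg * S₁.toLabelled 1 (fun _ => ()) Fh) ≠ 0) ∧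
          (∃ Δ : ℝ, 0 < Δ ∧ S₁.toLabelled.HasMassGap Δ ∧ HasLatticeMassGap r sch Δ)) := by
  constructor
  · intro h G _ _ _ _ hG
    letI : MeasurableSpace G := borel G
    haveI : BorelSpace G := ⟨rfl⟩
    obtain ⟨r, sch, S, hw, hos, hconv, hnt, hng, Δ, hΔ, hgap, hlat⟩ := h G hG
    exact ⟨r, sch, restrictTo r.curvature S, hw, osClauses_restrictTo _ hos,
      fun n hn f F hF hod => hconv n hn _ f F hF hod, hnt, hng, Δ, hΔ, hasMassGap_restrictTo _ hgap, hlat⟩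
  · intro h G _ _ _ _ hG
    letI : MeasurableSpace G := borel G
    haveI : BorelSpace G := ⟨rfl⟩
    obtain ⟨r, sch, S₁, hw, hos, hconv, hnt, hng, Δ, hΔ, hgap, hlat⟩ := h G hG
    refine ⟨r, { sch with c := fun s k => by classical exact if s = r.curvature then sch.c s k else 0 },
      extendByZero r.curvature S₁, hw,
      osClauses_extendByZero hos, ?_, ?_, ?_, Δ, hΔ, hasMassGap_extendByZero hgap, hlat⟩
    · intro n hn σ f F hF hod
      by_cases hσ : ∀ i, σ i = r.curvature
      · obtain rfl : σ = fun _ => r.curvature := funext hσ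
        rw [extendByZero_const]
        simp_rw [latticeSchwinger_silence_self]
        exact hconv n hn f F hF hod
      · push Not at hσ
        obtain ⟨i₀, hi₀⟩ := hσ
        rw [extendByZero_of_not_all _ _ (fun hall => hi₀ (hall i₀))]
        simp_rw [latticeSchwinger_silence_of_ne r sch r.curvature _ n σ f hi₀]
        simp
    · simpa using hnt
    · simpa using hng

end Summit.QuantumFields.YangMills.Theorems.HypercubicLimit.OneFieldWeak

end
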